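import Summits.CriticalPhenomena.Ising3DConformalLimit.Theses.BallSpecification
import Literature.Probability.LatticeModels.MoebiusWeightedAction
import Literature.Analysis.FunctionSpaces.SchwartzDistributionSupport
import HarnessLib

/-!
# Stub `stub_truncatedInversionCLM` of line `birth` (skeleton r2) for crux `BallSpecifiedInversionUpgrade` (stmt-CriticalPhenomena-11248)

Route `route-CriticalPhenomena-BallSpecification`, sub-problem `Ising3DConformalLimit`.  Target tree file:
`Summits/CriticalPhenomena/Ising3DConformalLimit/Theorems/BallSpecificationBallSpecifiedInversionUpgradeTruncatedInversionCLM.lean`,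
landed with `--supports stmt-CriticalPhenomena-11248` (the theorem name and statement below are the REGISTERED stub; do not change them).

## Content

For the unit inversion `ι = EuclideanGeometry.inversion 0 1` (`x ↦ x/‖x‖²`) of `E = ℝ³` and a weight `Δ`, the
weight-`Δ` pull-back `ι^*_Δ f = moebiusWeightedAction unitInversion Δ f` is only a partial operation on `𝓢(E)` (it is
the junk value `0` unless `f` has compact support off the origin).  For every annulus `R_s = {s < ‖x‖ < s⁻¹}`,
`0 < s`, we construct ONE continuous linear map `P s : 𝓢(E) →L[ℝ] 𝓢(E)` which agrees with `ι^*_Δ` on the test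
functions compactly supported in `R_s` and never moves supports onto the origin or outside `ι⁻¹(tsupport f)`:
`P s = (Φ •) ∘ (· ∘ ι̃)` with `ι̃ x = x + χ x • (ι x - x)` a compactly supported smooth modification of the identity
that equals `ι` on the shell `{s/2 ≤ ‖x‖ ≤ 2/s}` (so `ι̃` has temperate growth and `‖x‖ ≤ C (1 + ‖ι̃ x‖)`, whence
`SchwartzMap.compCLM` applies), and `Φ x = ψ x · (‖x‖²)⁻¹ ^ (3 - Δ)` with `ψ` a smooth cut-off equal to `1` on
`{s ≤ ‖x‖ ≤ s⁻¹}` and supported in `{s/2 < ‖x‖ < 2/s}` (smooth with compact support, hence a temperate multiplier for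
`SchwartzMap.smulLeftCLM`).  The cut-offs come from the smooth Urysohn lemma
`Literature.Analysis.FunctionSpaces.SchwartzSupport.exists_smooth_one_of_isCompact_subset_isOpen`.
-/

namespace Summit.CriticalPhenomena.Ising3DConformalLimit.BallSpecificationBallSpecifiedInversionUpgrade

open MeasureTheory
open scoped SchwartzMap ContDiff Topology
open Set Filter EuclideanGeometry Literature.Probability.LatticeModels

/-- Local notation for `ℝ³` as a Euclidean space. -/
local notation "E₃" => EuclideanSpace ℝ (Fin 3)

/-! ### Shells and the unit inversion -/

/-- The closed spherical shell `{a ≤ ‖x‖ ≤ b}` of `ℝ³` is compact (closed and bounded). [folklore] -/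
private theorem tic_isCompact_shell (a b : ℝ) : IsCompact {x : E₃ | a ≤ ‖x‖ ∧ ‖x‖ ≤ b} := by
  have h1 : IsClosed {x : E₃ | a ≤ ‖x‖ ∧ ‖x‖ ≤ b} := isClosed_Icc.preimage continuous_norm
  refine Metric.isCompact_of_isClosed_isBounded h1 ?_
  refine (Metric.isBounded_closedBall (x := (0 : E₃)) (r := b)).subset fun x hx => ?_
  rw [mem_closedBall_zero_iff]
  exact hx.2

/-- The open spherical shell `{a < ‖x‖ < b}` of `ℝ³` is open. [folklore] -/
private theorem tic_isOpen_shell (a b : ℝ) : IsOpen {x : E₃ | a < ‖x‖ ∧ ‖x‖ < b} :=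
  isOpen_Ioo.preimage continuous_norm

/-- `‖ι x‖ = ‖x‖⁻¹` for the unit inversion `ι = inversion 0 1`. [folklore] -/
private theorem tic_norm_inversion (x : E₃) : ‖inversion (0 : E₃) 1 x‖ = ‖x‖⁻¹ := by
  have h := dist_inversion_center (0 : E₃) x 1
  rwa [dist_zero_right, dist_zero_right, one_pow, one_div] at h

/-! ### The modified inversion `ι̃ x = x + χ x • (ι x - x)` -/

section IotaMod

variable {χ : E₃ → ℝ}

/-- `x ↦ χ x • (ι x - x)` is smooth when `χ` is smooth and vanishes near the origin (the only singularity of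
`ι`). [folklore] -/
private theorem tic_contDiff_smul_inversion_sub (hχ : ContDiff ℝ ∞ χ) (h0 : (0 : E₃) ∉ tsupport χ) :
    ContDiff ℝ ∞ (fun x => χ x • (inversion (0 : E₃) 1 x - x)) := by
  rw [contDiff_iff_contDiffAt]
  intro x
  by_cases hx : x = 0
  · subst hx
    have hev : (fun x => χ x • (inversion (0 : E₃) 1 x - x)) =ᶠ[𝓝 (0 : E₃)] fun _ => 0 := by
      filter_upwards [notMem_tsupport_iff_eventuallyEq.1 h0] with y hy
      rw [hy, Pi.zero_apply, zero_smul]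
    exact contDiffAt_const.congr_of_eventuallyEq hev
  · exact hχ.contDiffAt.smul
      ((ConformalChart.contDiffOn_unitInversion.contDiffAt (isOpen_compl_singleton.mem_nhds hx)).sub
        contDiffAt_id)

/-- For `g` of temperate growth, `x ↦ x + g x` has temperate growth. [folklore] -/
private theorem tic_hasTemperateGrowth_id_add {g : E₃ → E₃} (hg : g.HasTemperateGrowth) :
    (fun x => x + g x).HasTemperateGrowth := by
  fun_prop

/-- The modified inversion `ι̃ x = x + χ x • (ι x - x)` has temperate growth: it is the identity plus a smooth
compactly supported map. [folklore] -/
private theorem tic_hasTemperateGrowth_iotaMod (hχ : ContDiff ℝ ∞ χ) (hχc : HasCompactSupport χ)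
    (h0 : (0 : E₃) ∉ tsupport χ) :
    (fun x => x + χ x • (inversion (0 : E₃) 1 x - x)).HasTemperateGrowth := by
  have hg : (fun x => χ x • (inversion (0 : E₃) 1 x - x)).HasTemperateGrowth :=
    (hχc.smul_right (f' := fun x => inversion (0 : E₃) 1 x - x)).hasTemperateGrowth
      (tic_contDiff_smul_inversion_sub hχ h0)
  exact tic_hasTemperateGrowth_id_add hg

/-- The growth bound `‖x‖ ≤ C (1 + ‖ι̃ x‖)` required by `SchwartzMap.compCLM`: off the support of `χ` we have
`ι̃ x = x`, and on it `‖x‖ < 4/s`. [folklore] -/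
private theorem tic_upper_iotaMod {s : ℝ} (hs : 0 < s)
    (hχU : tsupport χ ⊆ {x : E₃ | s / 4 < ‖x‖ ∧ ‖x‖ < 4 / s}) :
    ∃ (k : ℕ) (C : ℝ), ∀ x : E₃, ‖x‖ ≤ C * (1 + ‖x + χ x • (inversion (0 : E₃) 1 x - x)‖) ^ k := by
  refine ⟨1, 1 + 4 / s, fun x => ?_⟩
  have h4 : 0 < 4 / s := by positivity
  rw [pow_one]
  by_cases hx : χ x = 0
  · rw [hx, zero_smul, add_zero]
    nlinarith [norm_nonneg x]
  · have hxU : ‖x‖ < 4 / s := (hχU (subset_tsupport _ hx)).2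
    nlinarith [norm_nonneg (x + χ x • (inversion (0 : E₃) 1 x - x))]

/-- Where `χ = 1`, the modified inversion is the inversion. [folklore] -/
private theorem tic_iotaMod_eq_of_eq_one {x : E₃} (hx : χ x = 1) :
    x + χ x • (inversion (0 : E₃) 1 x - x) = inversion (0 : E₃) 1 x := by
  rw [hx, one_smul, add_sub_cancel]

end IotaMod

/-! ### The multiplier `Φ x = ψ x · (‖x‖²)⁻¹ ^ p` -/

/-- `Φ x = ψ x · (‖x‖²)⁻¹ ^ p` is smooth when `ψ` is smooth and vanishes near the origin. [folklore] -/
private theorem tic_contDiff_phi {ψ : E₃ → ℝ} (hψ : ContDiff ℝ ∞ ψ) (h0 : (0 : E₃) ∉ tsupport ψ) (p : ℝ) :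
    ContDiff ℝ ∞ (fun x => ψ x * ((‖x‖ ^ 2)⁻¹) ^ p) := by
  rw [contDiff_iff_contDiffAt]
  intro x
  by_cases hx : x ∈ tsupport ψ
  · have hx0 : x ≠ 0 := by
      rintro rfl
      exact h0 hx
    have h1 : ‖x‖ ^ 2 ≠ 0 := by positivity
    have h2 : (‖x‖ ^ 2)⁻¹ ≠ 0 := inv_ne_zero h1
    exact hψ.contDiffAt.mul (((contDiff_norm_sq ℝ).contDiffAt.inv h1).rpow_const_of_ne h2)
  · have hev : (fun x => ψ x * ((‖x‖ ^ 2)⁻¹) ^ p) =ᶠ[𝓝 x] fun _ => 0 := by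
      filter_upwards [notMem_tsupport_iff_eventuallyEq.1 hx] with y hy
      rw [hy, Pi.zero_apply, zero_mul]
    exact contDiffAt_const.congr_of_eventuallyEq hev

/-! ### The truncated inversion operator on one annulus -/

/-- **The truncated weight-`Δ` inversion on the annulus `R_s = {s < ‖x‖ < s⁻¹}`**: a continuous linear
`Q : 𝓢(ℝ³) →L[ℝ] 𝓢(ℝ³)` with `Q f = ι^*_Δ f` for `f` compactly supported in `R_s`, and
`tsupport (Q f) ⊆ {0}ᶜ ∩ ι⁻¹(tsupport f)` for every `f`. [folklore] -/
private theorem tic_exists (Δ : ℝ) {s : ℝ} (hs : 0 < s) :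
    ∃ Q : 𝓢(E₃, ℝ) →L[ℝ] 𝓢(E₃, ℝ),
      (∀ f : 𝓢(E₃, ℝ), HasCompactSupport (f : E₃ → ℝ) →
        tsupport (f : E₃ → ℝ) ⊆ {x : E₃ | s < ‖x‖ ∧ ‖x‖ < s⁻¹} →
        Q f = moebiusWeightedAction ConformalChart.unitInversion Δ f) ∧
      (∀ (f : 𝓢(E₃, ℝ)) (x : E₃), x ∈ tsupport (Q f : E₃ → ℝ) →
        x ≠ 0 ∧ inversion (0 : E₃) 1 x ∈ tsupport (f : E₃ → ℝ)) := by
  have hs4 : 0 < 4 / s := by positivity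
  have hinv : 0 < s⁻¹ := inv_pos.2 hs
  have h2s : 2 / s = 2 * s⁻¹ := div_eq_mul_inv 2 s
  have h4s : 4 / s = 4 * s⁻¹ := div_eq_mul_inv 4 s
  -- the cut-off `χ` for the modified inversion: `χ = 1` on `{s/2 ≤ ‖x‖ ≤ 2/s}`, `supp χ ⊆ {s/4 < ‖x‖ < 4/s}`
  obtain ⟨χ, hχ, hχc, hχU, hχ1, -⟩ :=
    Literature.Analysis.FunctionSpaces.SchwartzSupport.exists_smooth_one_of_isCompact_subset_isOpen
      (tic_isCompact_shell (s / 2) (2 / s)) (tic_isOpen_shell (s / 4) (4 / s))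
      (fun x hx => ⟨by linarith [hx.1], by linarith [hx.2]⟩)
  -- the cut-off `ψ` for the multiplier: `ψ = 1` on `{s ≤ ‖x‖ ≤ s⁻¹}`, `supp ψ ⊆ {s/2 < ‖x‖ < 2/s}`
  obtain ⟨ψ, hψ, hψc, hψU, hψ1, -⟩ :=
    Literature.Analysis.FunctionSpaces.SchwartzSupport.exists_smooth_one_of_isCompact_subset_isOpen
      (tic_isCompact_shell s s⁻¹) (tic_isOpen_shell (s / 2) (2 / s))
      (fun x hx => ⟨by linarith [hx.1], by linarith [hx.2]⟩)
  have hχ0 : (0 : E₃) ∉ tsupport χ := fun h => by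
    have h' := (hχU h).1
    rw [norm_zero] at h'
    linarith
  have hψ0 : (0 : E₃) ∉ tsupport ψ := fun h => by
    have h' := (hψU h).1
    rw [norm_zero] at h'
    linarith
  -- the modified inversion and the multiplier
  have hιt := tic_hasTemperateGrowth_iotaMod hχ hχc hχ0
  have hιu := tic_upper_iotaMod hs hχU
  set ιm : E₃ → E₃ := fun x => x + χ x • (inversion (0 : E₃) 1 x - x) with hιm_def
  have hιm_eq : ∀ x : E₃, s / 2 ≤ ‖x‖ → ‖x‖ ≤ 2 / s → ιm x = inversion (0 : E₃) 1 x :=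
    fun x h1 h2 => tic_iotaMod_eq_of_eq_one (hχ1 x ⟨h1, h2⟩)
  set p : ℝ := (Module.finrank ℝ E₃ : ℝ) - Δ with hp_def
  have hΦt : (fun x => ψ x * ((‖x‖ ^ 2)⁻¹) ^ p).HasTemperateGrowth :=
    (hψc.mul_right (f' := fun x => ((‖x‖ ^ 2)⁻¹) ^ p)).hasTemperateGrowth (tic_contDiff_phi hψ hψ0 p)
  set Φ : E₃ → ℝ := fun x => ψ x * ((‖x‖ ^ 2)⁻¹) ^ p with hΦ_def
  set Q : 𝓢(E₃, ℝ) →L[ℝ] 𝓢(E₃, ℝ) :=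
    (SchwartzMap.smulLeftCLM ℝ Φ).comp (SchwartzMap.compCLM ℝ hιt hιu) with hQ_def
  have hQ : ∀ (f : 𝓢(E₃, ℝ)) (x : E₃), Q f x = Φ x * f (ιm x) := fun f x => by
    rw [hQ_def, ContinuousLinearMap.comp_apply, SchwartzMap.smulLeftCLM_apply_apply hΦt,
      SchwartzMap.compCLM_apply, Function.comp_apply, smul_eq_mul]
  have hcoe : ∀ f : 𝓢(E₃, ℝ), ((Q f : 𝓢(E₃, ℝ)) : E₃ → ℝ) = fun x => Φ x * f (ιm x) :=
    fun f => funext (hQ f)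
  refine ⟨Q, fun f hf hft => ?_, fun f x hx => ?_⟩
  · -- agreement with `ι^*_Δ` on test functions compactly supported in the annulus
    have hft0 : tsupport (f : E₃ → ℝ) ⊆ {0}ᶜ := fun y hy hy0 => by
      have h' := (hft hy).1
      rw [mem_singleton_iff.1 hy0, norm_zero] at h'
      linarith
    ext x
    rw [hQ]
    by_cases hx0 : x = 0
    · subst hx0
      rw [moebiusWeightedAction_apply_of_not_mem f (by simp), hΦ_def]
      dsimp only
      rw [image_eq_zero_of_notMem_tsupport hψ0, zero_mul, zero_mul]
    · rw [moebiusWeightedAction_unitInversion_apply hf hft0 hx0]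
      have hxpos : 0 < ‖x‖ := norm_pos_iff.2 hx0
      by_cases hK : s ≤ ‖x‖ ∧ ‖x‖ ≤ s⁻¹
      · have h1 : ψ x = 1 := hψ1 x hK
        have h2 : ιm x = inversion (0 : E₃) 1 x :=
          hιm_eq x (by linarith [hK.1]) (by linarith [hK.2])
        rw [h2, hΦ_def]
        dsimp only
        rw [h1, one_mul]
      · have hfx : f (inversion (0 : E₃) 1 x) = 0 := by
          apply image_eq_zero_of_notMem_tsupport
          intro hmem
          have h := hft hmem
          rw [mem_setOf_eq, tic_norm_inversion] at h
          exact hK ⟨((inv_lt_inv₀ hxpos hs).1 h.2).le, ((lt_inv_comm₀ hs hxpos).1 h.1).le⟩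
        rw [hfx, mul_zero]
        by_cases hψx : ψ x = 0
        · rw [hΦ_def]
          dsimp only
          rw [hψx, zero_mul, zero_mul]
        · have hxs := hψU (subset_tsupport _ hψx)
          rw [hιm_eq x hxs.1.le hxs.2.le, hfx, mul_zero]
  · -- support control: `tsupport (Q f) ⊆ tsupport ψ ∩ ι̃ ⁻¹' tsupport f`
    rw [hcoe f] at hx
    have hx1 : x ∈ tsupport ψ := tsupport_mul_subset_left (tsupport_mul_subset_left hx)
    have hx2 : x ∈ ιm ⁻¹' tsupport (f : E₃ → ℝ) :=
      tsupport_comp_subset_preimage (f : E₃ → ℝ) hιt.1.continuous (tsupport_mul_subset_right hx)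
    have hxs := hψU hx1
    have hx0 : x ≠ 0 := by
      rintro rfl
      rw [mem_setOf_eq, norm_zero] at hxs
      linarith [hxs.1]
    refine ⟨hx0, ?_⟩
    rw [← hιm_eq x hxs.1.le hxs.2.le]
    exact hx2

/-- Registered stub `stub_truncatedInversionCLM` of crux `BallSpecifiedInversionUpgrade` (stmt-CriticalPhenomena-11248), line `birth` r2. -/
theorem stub_truncatedInversionCLM :
    ∀ (Δ : ℝ), ∃ P : ℝ → (SchwartzMap (EuclideanSpace ℝ (Fin 3)) ℝ →L[ℝ] SchwartzMap (EuclideanSpace ℝ (Fin 3)) ℝ), ∀ s : ℝ, 0 < s → s < 1 → (∀ f : SchwartzMap (EuclideanSpace ℝ (Fin 3)) ℝ, HasCompactSupport (f : EuclideanSpace ℝ (Fin 3) → ℝ) → tsupport (f : EuclideanSpace ℝ (Fin 3) → ℝ) ⊆ {x : EuclideanSpace ℝ (Fin 3) | s < ‖x‖ ∧ ‖x‖ < s⁻¹} → P s f = Literature.Probability.LatticeModels.moebiusWeightedAction Literature.Probability.LatticeModels.ConformalChart.unitInversion Δ f) ∧ (∀ (f : SchwartzMap (EuclideanSpace ℝ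 (Fin 3)) ℝ) (x : EuclideanSpace ℝ (Fin 3)), x ∈ tsupport (P s f : EuclideanSpace ℝ (Fin 3) → ℝ) → x ≠ 0 ∧ EuclideanGeometry.inversion 0 1 x ∈ tsupport (f : EuclideanSpace ℝ (Fin 3) → ℝ)) := by
  intro Δ
  classical
  refine ⟨fun s => if hs : 0 < s then Classical.choose (tic_exists Δ hs) else 0, fun s hs _ => ?_⟩
  simp only [dif_pos hs]
  exact Classical.choose_spec (tic_exists Δ hs)

end Summit.CriticalPhenomena.Ising3DConformalLimit.BallSpecificationBallSpecifiedInversionUpgrade
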